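import Literature.MathematicalPhysics.QuantumFieldTheory.Balaban1983to89.B9Eq377CubeLettersProjection
import Literature.MathematicalPhysics.QuantumFieldTheory.Balaban1983to89.B9Eq383CubeLetters

/-!
# `Balaban1983to89.B9Thm311CubeLettersGSmallField` — [B9] Theorem 3.11 p. 416 ∕ (3.84)–(3.86) p. 407 FOR THE CUBE LETTER `Δ_{a,□}`, `G_□` AT A SMALL FIELD, THE
# `L²` CAPSTONE: coercivity of `Δ_{a,□}(U′)` WITH ITS CONSTANT (hence `IsUnit`, `G_□(U′) > 0`, `‖G_□(U′)‖ ≦ ((1−θ)m)⁻¹`) from the bond window `ρ`, the plaquette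
# window `δ`, a flat coercivity constant `m`, and ONE displayed number `σ` (the `L²` size of `R_□(1) − R_□(U′)`) — the Laplacian piece (`B9Eq373CubeLettersLaplacian`),
# the projection piece (`B9Eq377CubeLettersProjection`) and the averaging piece (r05's `B9Eq383CubeLetters`) COMBINED BY NAME; and the same at the original
# (3.35)-configuration through a `G`-valued gauge

statement-level skeleton of published theorems with citation tags; proofs where landed; nothing here is a claim about the Yang–Mills mass gap

T. Bałaban, *Propagators for lattice gauge theories in a background field*, Commun. Math. Phys. **99** (1985) 389–434 [`Balaban1985BackgroundPropagators`,
"[B9]"; held text `paper:balaban1985-cmp99-background-propagators`, journal page = PDF page + 388].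

THE PRINT (verbatim).  p. 407 (3.84)–(3.86): «Δ_a(U′U) = Δ_a(U) − V(A) = (I − V(A)G(U))Δ_a(U) … V(A)G(U) is a small operator … G(U′U) = G(U)(I − V(A)G(U))⁻¹»;
p. 416: «Doing the gauge transformation we get the configuration U = e^{iηA} with A small, and by (3.86) we get G_□(e^{iηA}) = G_□(1)(I − V(A)G_□(1))⁻¹. In [4] we
have proved that the operator G_□(1) is positive, hence by the same reasoning as above we prove positivity of G_□.»

WHY THIS FILE.  The assembly `B9Eq373CubeLettersLaplacian.deltaACubeY_coercive_of_windows` (✓ p624370) asks one-sided bounds for the projection and averaging pieces;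
`B9Eq377CubeLettersProjection.upperDiag_projection_piece` supplies the first from `σ` and `ρ`, r05 g82's ★★★ `B9Eq383CubeLetters.sqrt_trIP_QsaQCubeY_sub_one_le_of_forall`
((3.82)∕(3.83) at the cube letters) the second from `ρ` alone (constant `8b₁c_f²·Dρ(1 + Dρ)`, `D = (d+2)(L^k − 1)`).  THIS FILE plugs them in: Theorem 3.11 for the cube letter
at a unitary-valued small field, with its constant, from the two windows + `m` + `σ`; and along the (3.35) gauge at the original configuration
(`B9Thm311CubeLettersGCoerciveGauge.deltaACubeY_coercive_gaugeY_iff`).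

WHAT IS PROVED (sorry-free; 0 `def`).  `upperDiag_averaging_piece` (r05's `L²` bound read as the one-sided `(a₃, b₃, e₃) = (a_P, 0, 0)`), ★★★ `deltaACubeY_coercive_smallField`
(`(1 − θ)m⟨C,C⟩ ≦ ⟨C, Δ_{a,□}(U′)C⟩` with `θ = (12(d+1)c_f²δ + a_P)∕m + (2√(32(d+1)c_f²)ρ + 4√((d+1)c_f²)(σ + ρ))∕√m + δ`), ★★★ `GACubeY_bounds_smallField`
(`θ < 1`: `Δ_{a,□}(U′) > 0`, `IsUnit`, `G_□(U′) > 0`, `(1−θ)m⟨B,G_□(U′)B⟩ ≦ ⟨B,B⟩`, `((1−θ)m)²‖G_□(U′)B‖² ≦ ‖B‖²`), ★★ `GACubeY_bounds_smallFieldGauge` (the same at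
the ORIGINAL `U` from the data at `U^u`, `u` `G`-valued).

HONEST SCOPE.  Bookkeeping over the three piece files; DISPLAYED: the windows `ρ`, `δ` (asked on the whole member torus — r05's localisation caveat), the flat constant `m`
([4] (2.22); ∃ by `exists_coercive_deltaACubeY_parSymY_one`), and `σ` (print's `P₁(A)`, (3.76)–(3.77) — Theorems 3.1∕3.2 for the cube letters; NOT proved anywhere yet).
SCALES (numbers, not adjectives): the coefficient of `ρ` in `θ` is `(2√(32(d+1)) + 4√(d+1))·c_f∕√m` and that of `δ` is `12(d+1)c_f²∕m + 1`, with `c_f = η⁻¹` the member's inverse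
spacing; so `θ < 1` forces `‖U′_b − 1‖ ≲ η√m` on EVERY bond and `‖U′(∂p) − 1‖ ≲ η²m` on EVERY plaquette — this is print's domain (3.37)∕(3.35) AT THE TOP LEVEL ONLY (`Lʲη ≍ 1`:
`|A| < α₁(Lʲη)⁻¹ ≍ α₁`, `|U(∂p) − 1| ≦ O(1)Mα₀(Lʲη)⁻²η²`), i.e. the COMPLETELY-SMALL-FIELD REGIME; (3.37)'s level-`j` cubes with `Lʲη ≪ 1` admit `‖U′_b − 1‖` up to `α₁L^{−j} ≫ η`
and are NOT covered — there print's (3.85) `|V(A)G| ≦ O(1)α₁` rests on the position-dependent kernel bounds of Thm 3.3 (lit-balaban M5.1b), not on an `L²` relative bound.  `L²`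
only; count-neutral; NOT a node discharge; no summit ∕ sub-problem claim (rungs R3∕R4 conditional; nothing continuum ∕ OS ∕ mass gap; not Clay).  No
`sorry`∕`axiom`∕`instance`∕`notation`; NEW file.  Seat `ym-inputs-p02`, cell `pub/ym-inputs`, 2026-08-28.
-/

namespace Literature.MathematicalPhysics.QuantumFieldTheory.Balaban1983to89.B9Thm311CubeLettersGSmallField

open B9Thm311ReadingCoords B9Thm311DeltaPrimePos B9Thm31SiteGpBoundsReg335Y Node00 B9CubeLettersBondOpsL0
  B9Thm311AdjointAtLetters B9Thm311CubeLettersFirstThree B9Thm311CubeLettersG B9Thm311CubeLettersGCoercive B9Eq382CubeLetters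
  B9Thm311CubeLettersGCoerciveGauge B9Thm311CubeLettersGCoerciveDiag B9Ineq369CurvatureSmallAtLettersY B9Thm311CoercivePureGaugeAtLettersY
  B9Eq373CubeLettersLaplacian B9Eq377CubeLettersProjection B9Eq383CubeLetters B9Thm311DeltaAGaugeOrbit
open Literature.MathematicalPhysics.QuantumFieldTheory.Balaban1983to89.B6KLevelCensusIndexV1 (KIdx)
open Literature.MathematicalPhysics.QuantumFieldTheory.Balaban1983to89.B6Cover236MultiLevelBlocks (cubes)
open Literature.MathematicalPhysics.QuantumFieldTheory.Balaban1983to89.B9Eq3132CoerciveVariational (trIP_sub_right)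
open Literature.MathematicalPhysics.QuantumFieldTheory.Balaban1983to89.T4RelativeLadder (UnitaryLike)
open scoped Matrix

noncomputable section

section SmallField

open scoped Matrix.Norms.L2Operator

variable {d ℓ : ℕ} {hd : 1 ≤ d + 1} {hL : Odd (ℓ + 1) ∧ 1 < ℓ + 1} {b₀ b₁ : ℝ} {N : ℕ} [Nonempty (Fin N)]
variable (i : KIdx d ℓ hd hL b₀ b₁) (q : ↥(cubes (toKT i).D.toDomains)) {G : Subgroup (Matrix (Fin N) (Fin N) ℂ)ˣ}

/-- **THE AVERAGING PIECE, ONE-SIDED** (r05's ★★★ `sqrt_trIP_QsaQCubeY_sub_one_le_of_forall` read through Cauchy–Schwarz): for a unitary-valued `U′` with bond window `ρ`,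
`⟨C, (Q*_□(1)aQ_□(1) − Q*_□(U′)aQ_□(U′))C⟩ ≦ a_P·⟨C,C⟩`, `a_P = 8b₁c_f²·Dρ(1 + Dρ)`, `D = (d+2)((ℓ+1)^k − 1)`.
[cite: Balaban1985BackgroundPropagators, (3.82)–(3.83) p.407] -/
theorem upperDiag_averaging_piece (hb₀ : 0 < b₀) (hb₁ : b₀ ≤ b₁) {U : CfgY (Matrix (Fin N) (Fin N) ℂ) i}
    (hU : ∀ μ x, ((U μ x : (Matrix (Fin N) (Fin N) ℂ)ˣ) : Matrix (Fin N) (Fin N) ℂ) ∈ unitary (Matrix (Fin N) (Fin N) ℂ)) {ρ : ℝ} (hρ0 : 0 ≤ ρ)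
    (hρ : ∀ μ x, ‖((U μ x : (Matrix (Fin N) (Fin N) ℂ)ˣ) : Matrix (Fin N) (Fin N) ℂ) - 1‖ ≤ ρ) (C : FBondY i → Matrix (Fin N) (Fin N) ℂ) :
    trIP (fun _ => (1 : ℝ)) C
        ((QsCubeY i q (parBY i) (fun _ _ => 1 : CfgY (Matrix (Fin N) (Fin N) ℂ) i) ∘ₗ aCubeY i q ∘ₗ QCubeY i q (parBY i) (fun _ _ => 1 : CfgY (Matrix (Fin N) (Fin N) ℂ) i) -
          QsCubeY i q (parBY i) U ∘ₗ aCubeY i q ∘ₗ QCubeY i q (parBY i) U) C) ≤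
      (8 * b₁ * i.cf ^ 2 * ((((d + 2) * ((ℓ + 1) ^ i.k - 1) : ℕ) : ℝ) * ρ) * (1 + (((d + 2) * ((ℓ + 1) ^ i.k - 1) : ℕ) : ℝ) * ρ)) *
          trIP (fun _ => (1 : ℝ)) C C +
        0 * Real.sqrt (trIP (fun _ => (1 : ℝ)) C C) *
          Real.sqrt (trIP (fun _ => (1 : ℝ)) C (deltaACubeY i q (parSymY i) (parBY i) (fun _ _ => 1 : CfgY (Matrix (Fin N) (Fin N) ℂ) i) C)) +
        0 * trIP (fun _ => (1 : ℝ)) C (deltaACubeY i q (parSymY i) (parBY i) (fun _ _ => 1 : CfgY (Matrix (Fin N) (Fin N) ℂ) i) C) := by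
  have hw : ∀ _ : FBondY i, (0 : ℝ) < 1 := fun _ => one_pos
  have hUL : ∀ μ x, UnitaryLike (U μ x) := fun μ x => contractive_of_mem_unitary (hU μ x)
  have hP := sqrt_trIP_QsaQCubeY_sub_one_le_of_forall i q hb₀ hb₁ hUL hρ0 hρ C
  have h1 : (1 : CfgY (Matrix (Fin N) (Fin N) ℂ) i) = (fun _ _ => 1 : CfgY (Matrix (Fin N) (Fin N) ℂ) i) := rfl
  rw [h1] at hP
  set P := QsCubeY i q (parBY i) U ∘ₗ aCubeY i q ∘ₗ QCubeY i q (parBY i) U -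
    QsCubeY i q (parBY i) (fun _ _ => 1 : CfgY (Matrix (Fin N) (Fin N) ℂ) i) ∘ₗ aCubeY i q ∘ₗ QCubeY i q (parBY i) (fun _ _ => 1 : CfgY (Matrix (Fin N) (Fin N) ℂ) i)
    with hPdef
  have hneg : (QsCubeY i q (parBY i) (fun _ _ => 1 : CfgY (Matrix (Fin N) (Fin N) ℂ) i) ∘ₗ aCubeY i q ∘ₗ QCubeY i q (parBY i) (fun _ _ => 1 : CfgY (Matrix (Fin N) (Fin N) ℂ) i) -
      QsCubeY i q (parBY i) U ∘ₗ aCubeY i q ∘ₗ QCubeY i q (parBY i) U) C = -(P C) := by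
    rw [hPdef, LinearMap.sub_apply, LinearMap.sub_apply, neg_sub]
  rw [hneg, zero_mul, zero_mul, zero_mul, add_zero, add_zero, B9Thm311DeltaAFrustratedWitness.trIP_neg_right]
  have hcs := abs_trIP_le (fun _ => (1 : ℝ)) hw C (P C)
  have hcc : Real.sqrt (trIP (fun _ => (1 : ℝ)) C C) * Real.sqrt (trIP (fun _ => (1 : ℝ)) C C) = trIP (fun _ => (1 : ℝ)) C C :=
    Real.mul_self_sqrt (trIP_self_nonneg _ hw C)
  have h3 := mul_le_mul_of_nonneg_left hP (Real.sqrt_nonneg (trIP (fun _ => (1 : ℝ)) C C))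
  have h4 : Real.sqrt (trIP (fun _ => (1 : ℝ)) C C) *
      ((8 * b₁ * i.cf ^ 2 * ((((d + 2) * ((ℓ + 1) ^ i.k - 1) : ℕ) : ℝ) * ρ) * (1 + (((d + 2) * ((ℓ + 1) ^ i.k - 1) : ℕ) : ℝ) * ρ)) *
        Real.sqrt (trIP (fun _ => (1 : ℝ)) C C)) =
      (8 * b₁ * i.cf ^ 2 * ((((d + 2) * ((ℓ + 1) ^ i.k - 1) : ℕ) : ℝ) * ρ) * (1 + (((d + 2) * ((ℓ + 1) ^ i.k - 1) : ℕ) : ℝ) * ρ)) *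
        (Real.sqrt (trIP (fun _ => (1 : ℝ)) C C) * Real.sqrt (trIP (fun _ => (1 : ℝ)) C C)) := by ring
  rw [hcc] at h4
  linarith [neg_le_abs (trIP (fun _ => (1 : ℝ)) C (P C)), hcs, h3, h4]

/-- ★★★ **THEOREM 3.11 FOR THE CUBE LETTER AT A SMALL FIELD, WITH ITS CONSTANT**: at def-Y's v4 transporters (`0 < b₀ ≦ b₁`), for a `G`-valued `U′` (`G ≦ U(N)`) with bond window
`‖U′_μ(x) − 1‖ ≦ ρ`, plaquette window `‖U′(∂p) − 1‖ ≦ δ ≦ 1`, a flat coercivity `m⟨C,C⟩ ≦ ⟨C, Δ_{a,□}(1)C⟩`, and a number `σ` with `‖(R_□(1) − R_□(U′))f‖ ≦ σ‖f‖` (DISPLAYED):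
with `a := 12(d+1)c_f²δ + a_P`, `b := 2√(32(d+1)c_f²)ρ + 4√((d+1)c_f²)(σ + ρ)`, `e := δ`, `θ := a∕m + b∕√m + e ≦ 1`: `(1 − θ)m·⟨C,C⟩ ≦ ⟨C, Δ_{a,□}(U′)C⟩`.
SCALES: `c_f = η⁻¹`, so `θ ≦ 1` is the completely-small-field regime `‖U′_b − 1‖ ≲ η√m`, `‖U′(∂p) − 1‖ ≲ η²m` (print's (3.37)∕(3.35) at the top level); see the header.
[cite: Balaban1985BackgroundPropagators, Thm 3.11 p.416, (3.82)–(3.86) p.407, (3.73) p.405, (3.77) p.406, (3.83) p.407] -/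
theorem deltaACubeY_coercive_smallField (hb₀ : 0 < b₀) (hb₁ : b₀ ≤ b₁) (hG : G ≤ B7Prop2Explicit.unitaryUnits (Matrix (Fin N) (Fin N) ℂ))
    {U : CfgY (Matrix (Fin N) (Fin N) ℂ) i} (hU : ∀ μ x, U μ x ∈ G) {ρ δ σ m : ℝ} (hρ0 : 0 ≤ ρ)
    (hρ : ∀ μ x, ‖((U μ x : (Matrix (Fin N) (Fin N) ℂ)ˣ) : Matrix (Fin N) (Fin N) ℂ) - 1‖ ≤ ρ) (hδ0 : 0 ≤ δ) (hδ1 : δ ≤ 1)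
    (hδ : ∀ p : PlaqY i, ‖((holY i U p : (Matrix (Fin N) (Fin N) ℂ)ˣ) : Matrix (Fin N) (Fin N) ℂ) - 1‖ ≤ δ) (hσ0 : 0 ≤ σ)
    (hσ : ∀ f : SiteY i → Matrix (Fin N) (Fin N) ℂ,
      Real.sqrt (trIP (fun _ => (1 : ℝ))
        ((RCubeY i q (parSymY i) (fun _ _ => 1 : CfgY (Matrix (Fin N) (Fin N) ℂ) i) - RCubeY i q (parSymY i) U) f)
        ((RCubeY i q (parSymY i) (fun _ _ => 1 : CfgY (Matrix (Fin N) (Fin N) ℂ) i) - RCubeY i q (parSymY i) U) f)) ≤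
      σ * Real.sqrt (trIP (fun _ => (1 : ℝ)) f f))
    (hm : 0 < m)
    (hco : ∀ C, m * trIP (fun _ => (1 : ℝ)) C C ≤
      trIP (fun _ => (1 : ℝ)) C (deltaACubeY i q (parSymY i) (parBY i) (fun _ _ => 1 : CfgY (Matrix (Fin N) (Fin N) ℂ) i) C))
    (hθ : (12 * (d + 1) * i.cf ^ 2 * δ + 0 +
          8 * b₁ * i.cf ^ 2 * ((((d + 2) * ((ℓ + 1) ^ i.k - 1) : ℕ) : ℝ) * ρ) * (1 + (((d + 2) * ((ℓ + 1) ^ i.k - 1) : ℕ) : ℝ) * ρ)) / m +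
        (2 * Real.sqrt (32 * (d + 1) * i.cf ^ 2) * ρ + 4 * Real.sqrt ((d + 1) * i.cf ^ 2) * (σ + ρ) + 0) / Real.sqrt m + (δ + 0 + 0) ≤ 1)
    (C : FBondY i → Matrix (Fin N) (Fin N) ℂ) :
    ((1 - ((12 * (d + 1) * i.cf ^ 2 * δ + 0 +
          8 * b₁ * i.cf ^ 2 * ((((d + 2) * ((ℓ + 1) ^ i.k - 1) : ℕ) : ℝ) * ρ) * (1 + (((d + 2) * ((ℓ + 1) ^ i.k - 1) : ℕ) : ℝ) * ρ)) / m +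
        (2 * Real.sqrt (32 * (d + 1) * i.cf ^ 2) * ρ + 4 * Real.sqrt ((d + 1) * i.cf ^ 2) * (σ + ρ) + 0) / Real.sqrt m + (δ + 0 + 0))) * m) *
        trIP (fun _ => (1 : ℝ)) C C ≤
      trIP (fun _ => (1 : ℝ)) C (deltaACubeY i q (parSymY i) (parBY i) U C) := by
  have hU' : ∀ μ x, ((U μ x : (Matrix (Fin N) (Fin N) ℂ)ˣ) : Matrix (Fin N) (Fin N) ℂ) ∈ unitary (Matrix (Fin N) (Fin N) ℂ) := fun μ x => hG (hU μ x)
  have hb1 : 0 < b₁ := hb₀.trans_le hb₁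
  exact deltaACubeY_coercive_of_windows i q hb₀ hU' hρ0 hρ hδ0 hδ1 hδ hm le_rfl (by positivity) (by positivity) le_rfl hco
    (upperDiag_projection_piece i q hb₀ hG hU hρ0 hσ0 hρ hσ) (upperDiag_averaging_piece i q hb₀ hb₁ hU' hρ0 hρ) hθ C

/-- ★★★ **… HENCE, FOR `θ < 1`**: `Δ_{a,□}(U′) > 0`, `IsUnit`, `G_□(U′) > 0`, `(1 − θ)m⟨B, G_□(U′)B⟩ ≦ ⟨B,B⟩`, `((1 − θ)m)²‖G_□(U′)B‖² ≦ ‖B‖²` («G_□(e^{iηA}) = G_□(1)(I −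
V(A)G_□(1))⁻¹ … we prove positivity of G_□», with the `L²` size). [cite: Balaban1985BackgroundPropagators, Thm 3.11 p.416, (3.86) p.407, (3.27) p.395, p.409 l.3–5] -/
theorem GACubeY_bounds_smallField (hb₀ : 0 < b₀) (hb₁ : b₀ ≤ b₁) (hG : G ≤ B7Prop2Explicit.unitaryUnits (Matrix (Fin N) (Fin N) ℂ))
    {U : CfgY (Matrix (Fin N) (Fin N) ℂ) i} (hU : ∀ μ x, U μ x ∈ G) {ρ δ σ m : ℝ} (hρ0 : 0 ≤ ρ)
    (hρ : ∀ μ x, ‖((U μ x : (Matrix (Fin N) (Fin N) ℂ)ˣ) : Matrix (Fin N) (Fin N) ℂ) - 1‖ ≤ ρ) (hδ0 : 0 ≤ δ) (hδ1 : δ ≤ 1)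
    (hδ : ∀ p : PlaqY i, ‖((holY i U p : (Matrix (Fin N) (Fin N) ℂ)ˣ) : Matrix (Fin N) (Fin N) ℂ) - 1‖ ≤ δ) (hσ0 : 0 ≤ σ)
    (hσ : ∀ f : SiteY i → Matrix (Fin N) (Fin N) ℂ,
      Real.sqrt (trIP (fun _ => (1 : ℝ))
        ((RCubeY i q (parSymY i) (fun _ _ => 1 : CfgY (Matrix (Fin N) (Fin N) ℂ) i) - RCubeY i q (parSymY i) U) f)
        ((RCubeY i q (parSymY i) (fun _ _ => 1 : CfgY (Matrix (Fin N) (Fin N) ℂ) i) - RCubeY i q (parSymY i) U) f)) ≤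
      σ * Real.sqrt (trIP (fun _ => (1 : ℝ)) f f))
    (hm : 0 < m)
    (hco : ∀ C, m * trIP (fun _ => (1 : ℝ)) C C ≤
      trIP (fun _ => (1 : ℝ)) C (deltaACubeY i q (parSymY i) (parBY i) (fun _ _ => 1 : CfgY (Matrix (Fin N) (Fin N) ℂ) i) C))
    (hθ : (12 * (d + 1) * i.cf ^ 2 * δ + 0 +
          8 * b₁ * i.cf ^ 2 * ((((d + 2) * ((ℓ + 1) ^ i.k - 1) : ℕ) : ℝ) * ρ) * (1 + (((d + 2) * ((ℓ + 1) ^ i.k - 1) : ℕ) : ℝ) * ρ)) / m +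
        (2 * Real.sqrt (32 * (d + 1) * i.cf ^ 2) * ρ + 4 * Real.sqrt ((d + 1) * i.cf ^ 2) * (σ + ρ) + 0) / Real.sqrt m + (δ + 0 + 0) < 1) :
    PosDefTr (fun _ => (1 : ℝ)) (deltaACubeY i q (parSymY i) (parBY i) U) ∧ IsUnit (deltaACubeY i q (parSymY i) (parBY i) U) ∧
      PosDefTr (fun _ => (1 : ℝ)) (GACubeY i q (parSymY i) (parBY i) U) ∧
      (∀ B : FBondY i → Matrix (Fin N) (Fin N) ℂ,
        ((1 - ((12 * (d + 1) * i.cf ^ 2 * δ + 0 +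
          8 * b₁ * i.cf ^ 2 * ((((d + 2) * ((ℓ + 1) ^ i.k - 1) : ℕ) : ℝ) * ρ) * (1 + (((d + 2) * ((ℓ + 1) ^ i.k - 1) : ℕ) : ℝ) * ρ)) / m +
        (2 * Real.sqrt (32 * (d + 1) * i.cf ^ 2) * ρ + 4 * Real.sqrt ((d + 1) * i.cf ^ 2) * (σ + ρ) + 0) / Real.sqrt m + (δ + 0 + 0))) * m) *
          trIP (fun _ => (1 : ℝ)) B (GACubeY i q (parSymY i) (parBY i) U B) ≤ trIP (fun _ => (1 : ℝ)) B B) ∧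
      (∀ B : FBondY i → Matrix (Fin N) (Fin N) ℂ,
        ((1 - ((12 * (d + 1) * i.cf ^ 2 * δ + 0 +
          8 * b₁ * i.cf ^ 2 * ((((d + 2) * ((ℓ + 1) ^ i.k - 1) : ℕ) : ℝ) * ρ) * (1 + (((d + 2) * ((ℓ + 1) ^ i.k - 1) : ℕ) : ℝ) * ρ)) / m +
        (2 * Real.sqrt (32 * (d + 1) * i.cf ^ 2) * ρ + 4 * Real.sqrt ((d + 1) * i.cf ^ 2) * (σ + ρ) + 0) / Real.sqrt m + (δ + 0 + 0))) * m) ^ 2 *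
            trIP (fun _ => (1 : ℝ)) (GACubeY i q (parSymY i) (parBY i) U B) (GACubeY i q (parSymY i) (parBY i) U B) ≤ trIP (fun _ => (1 : ℝ)) B B) := by
  have hw : ∀ _ : FBondY i, (0 : ℝ) < 1 := fun _ => one_pos
  have hco' := deltaACubeY_coercive_smallField i q hb₀ hb₁ hG hU hρ0 hρ hδ0 hδ1 hδ hσ0 hσ hm hco hθ.le
  have hm' : 0 < (1 - ((12 * (d + 1) * i.cf ^ 2 * δ + 0 +
          8 * b₁ * i.cf ^ 2 * ((((d + 2) * ((ℓ + 1) ^ i.k - 1) : ℕ) : ℝ) * ρ) * (1 + (((d + 2) * ((ℓ + 1) ^ i.k - 1) : ℕ) : ℝ) * ρ)) / m +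
        (2 * Real.sqrt (32 * (d + 1) * i.cf ^ 2) * ρ + 4 * Real.sqrt ((d + 1) * i.cf ^ 2) * (σ + ρ) + 0) / Real.sqrt m + (δ + 0 + 0))) * m :=
    mul_pos (by linarith) hm
  have hpos : PosDefTr (fun _ => (1 : ℝ)) (deltaACubeY i q (parSymY i) (parBY i) U) := posDefTr_of_coercive hw hm' hco'
  exact ⟨hpos, isUnit_of_posDefTr hpos, posDefTr_ringInverse hpos, fun B => trIP_ringInverse_le hw hm' hco' B,
    fun B => trIP_ringInverse_self_le hw hm' hco' B⟩

/-- ★★ **… AND AT THE ORIGINAL (3.35)-CONFIGURATION, THROUGH THE GAUGE**: if the windows `ρ`, `δ`, the number `σ` and `θ < 1` hold at the gauge transform `U^u`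
(`u` `G`-valued — print's «doing the gauge transformation we get the configuration U = e^{iηA} with A small»), then the conclusions of `GACubeY_bounds_smallField` hold
at `U` itself (`Δ_{a,□}(U^u) = 𝒰Δ_{a,□}(U)𝒰⁻¹`, `𝒰` an `L²`-isometry: `B9Thm311CubeLettersGCoerciveGauge.deltaACubeY_coercive_gaugeY_iff`).
[cite: Balaban1985BackgroundPropagators, Thm 3.11 p.416, (3.35) p.397, (3.86) p.407] -/
theorem GACubeY_bounds_smallFieldGauge (hb₀ : 0 < b₀) (hb₁ : b₀ ≤ b₁) (hG : G ≤ B7Prop2Explicit.unitaryUnits (Matrix (Fin N) (Fin N) ℂ))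
    {U : CfgY (Matrix (Fin N) (Fin N) ℂ) i} {u : GaugeY (Matrix (Fin N) (Fin N) ℂ) i} (hu : ∀ x, u x ∈ G) (hUu : ∀ μ x, gaugeY i u U μ x ∈ G)
    {ρ δ σ m : ℝ} (hρ0 : 0 ≤ ρ)
    (hρ : ∀ μ x, ‖((gaugeY i u U μ x : (Matrix (Fin N) (Fin N) ℂ)ˣ) : Matrix (Fin N) (Fin N) ℂ) - 1‖ ≤ ρ) (hδ0 : 0 ≤ δ) (hδ1 : δ ≤ 1)
    (hδ : ∀ p : PlaqY i, ‖((holY i (gaugeY i u U) p : (Matrix (Fin N) (Fin N) ℂ)ˣ) : Matrix (Fin N) (Fin N) ℂ) - 1‖ ≤ δ) (hσ0 : 0 ≤ σ)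
    (hσ : ∀ f : SiteY i → Matrix (Fin N) (Fin N) ℂ,
      Real.sqrt (trIP (fun _ => (1 : ℝ))
        ((RCubeY i q (parSymY i) (fun _ _ => 1 : CfgY (Matrix (Fin N) (Fin N) ℂ) i) - RCubeY i q (parSymY i) (gaugeY i u U)) f)
        ((RCubeY i q (parSymY i) (fun _ _ => 1 : CfgY (Matrix (Fin N) (Fin N) ℂ) i) - RCubeY i q (parSymY i) (gaugeY i u U)) f)) ≤
      σ * Real.sqrt (trIP (fun _ => (1 : ℝ)) f f))
    (hm : 0 < m)
    (hco : ∀ C, m * trIP (fun _ => (1 : ℝ)) C C ≤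
      trIP (fun _ => (1 : ℝ)) C (deltaACubeY i q (parSymY i) (parBY i) (fun _ _ => 1 : CfgY (Matrix (Fin N) (Fin N) ℂ) i) C))
    (hθ : ((12 * (d + 1) * i.cf ^ 2 * δ + 0 +
          8 * b₁ * i.cf ^ 2 * ((((d + 2) * ((ℓ + 1) ^ i.k - 1) : ℕ) : ℝ) * ρ) * (1 + (((d + 2) * ((ℓ + 1) ^ i.k - 1) : ℕ) : ℝ) * ρ)) / m +
        (2 * Real.sqrt (32 * (d + 1) * i.cf ^ 2) * ρ + 4 * Real.sqrt ((d + 1) * i.cf ^ 2) * (σ + ρ) + 0) / Real.sqrt m + (δ + 0 + 0)) < 1) :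
    PosDefTr (fun _ => (1 : ℝ)) (deltaACubeY i q (parSymY i) (parBY i) U) ∧ IsUnit (deltaACubeY i q (parSymY i) (parBY i) U) ∧
      PosDefTr (fun _ => (1 : ℝ)) (GACubeY i q (parSymY i) (parBY i) U) ∧
      (∀ B : FBondY i → Matrix (Fin N) (Fin N) ℂ,
        ((1 - ((12 * (d + 1) * i.cf ^ 2 * δ + 0 +
          8 * b₁ * i.cf ^ 2 * ((((d + 2) * ((ℓ + 1) ^ i.k - 1) : ℕ) : ℝ) * ρ) * (1 + (((d + 2) * ((ℓ + 1) ^ i.k - 1) : ℕ) : ℝ) * ρ)) / m +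
        (2 * Real.sqrt (32 * (d + 1) * i.cf ^ 2) * ρ + 4 * Real.sqrt ((d + 1) * i.cf ^ 2) * (σ + ρ) + 0) / Real.sqrt m + (δ + 0 + 0))) * m) *
          trIP (fun _ => (1 : ℝ)) B (GACubeY i q (parSymY i) (parBY i) U B) ≤ trIP (fun _ => (1 : ℝ)) B B) ∧
      (∀ B : FBondY i → Matrix (Fin N) (Fin N) ℂ,
        ((1 - ((12 * (d + 1) * i.cf ^ 2 * δ + 0 +
          8 * b₁ * i.cf ^ 2 * ((((d + 2) * ((ℓ + 1) ^ i.k - 1) : ℕ) : ℝ) * ρ) * (1 + (((d + 2) * ((ℓ + 1) ^ i.k - 1) : ℕ) : ℝ) * ρ)) / m +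
        (2 * Real.sqrt (32 * (d + 1) * i.cf ^ 2) * ρ + 4 * Real.sqrt ((d + 1) * i.cf ^ 2) * (σ + ρ) + 0) / Real.sqrt m + (δ + 0 + 0))) * m) ^ 2 *
            trIP (fun _ => (1 : ℝ)) (GACubeY i q (parSymY i) (parBY i) U B) (GACubeY i q (parSymY i) (parBY i) U B) ≤ trIP (fun _ => (1 : ℝ)) B B) := by
  have hw : ∀ _ : FBondY i, (0 : ℝ) < 1 := fun _ => one_pos
  have hu' : ∀ x, ((u x : (Matrix (Fin N) (Fin N) ℂ)ˣ) : Matrix (Fin N) (Fin N) ℂ) ∈ unitary _ := fun x => hG (hu x)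
  have h1 := deltaACubeY_coercive_smallField i q hb₀ hb₁ hG hUu hρ0 hρ hδ0 hδ1 hδ hσ0 hσ hm hco hθ.le
  have hco' := (deltaACubeY_coercive_gaugeY_iff i q (parSymY_isGaugeLawS i) (parBY_isGaugeLawB i) hu' U).mp h1
  have hm' : 0 < (1 - ((12 * (d + 1) * i.cf ^ 2 * δ + 0 +
          8 * b₁ * i.cf ^ 2 * ((((d + 2) * ((ℓ + 1) ^ i.k - 1) : ℕ) : ℝ) * ρ) * (1 + (((d + 2) * ((ℓ + 1) ^ i.k - 1) : ℕ) : ℝ) * ρ)) / m +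
        (2 * Real.sqrt (32 * (d + 1) * i.cf ^ 2) * ρ + 4 * Real.sqrt ((d + 1) * i.cf ^ 2) * (σ + ρ) + 0) / Real.sqrt m + (δ + 0 + 0))) * m :=
    mul_pos (by linarith) hm
  have hpos : PosDefTr (fun _ => (1 : ℝ)) (deltaACubeY i q (parSymY i) (parBY i) U) := posDefTr_of_coercive hw hm' hco'
  exact ⟨hpos, isUnit_of_posDefTr hpos, posDefTr_ringInverse hpos, fun B => trIP_ringInverse_le hw hm' hco' B,
    fun B => trIP_ringInverse_self_le hw hm' hco' B⟩

end SmallField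

end

end Literature.MathematicalPhysics.QuantumFieldTheory.Balaban1983to89.B9Thm311CubeLettersGSmallField
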